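import Literature.Computability.QuantumComplexity.ZXCalculusScalarLemmas
import HarnessLib

/-!
# `ZX_{π/4}` modulo the calculus: the H-loop (JPV Lemma 9), Hadamard tensors and wires, and π-copy (K1) = JPV Lemma 4

Topic `Literature/Computability/QuantumComplexity`, continuing `ZXCalculusScalarLemmas.lean`: layers A13–A16 of the
formalisation of `JeandelPerdrixVilmart2018_completeness`, merged into one module. Four parts, each with its own header
below: (A13) plumbing, (EU) on states, and JPV Lemma 9 (the H-loop is a green `π`); (A14) Hadamard tensors `H^{⊗n}` and the
colour-change rule (H) in usable forms; (A15) Hadamard wires: parallel and antiparallel pairs of Hadamard boxes between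
spiders; (A16) `pidotcopy` and **JPV Lemma 4 = (K1)**, the `π`-copy rule, derived from Figure 1 (route of
Backens–Perdrix–Wang, QPL 2016, shortened). [cite: JeandelPerdrixVilmart2018, Appendix Lemmas 4, 9]
-/

/-! ## Part: `ZXCalculusHLoop.lean` -/
/-!
# `ZX_{π/4}` modulo the calculus: the Hadamard loop (JPV Lemma 9)

Topic `Literature/Computability/QuantumComplexity`, continuing `ZXCalculusAngleDelete.lean` (layer
A13 of the formalisation of `JeandelPerdrixVilmart2018_completeness`): Backens–Perdrix–Wang's Lemma
`lem:anglefreepi` = JPV's appendix Lemma 9: a green `π` phase on a wire is, up to the scalar `√2`,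
a phase-free green node two of whose legs are joined through a Hadamard box,
`√2 ⊗ (Z^{(1,3)}(0) ⨾ (𝕀 ⊗ ((H ⊗ 𝕀) ⨾ ε))) = Z^{(1,1)}(π)` (`sqrt_two_par_hLoop`).

Derivation (1602.04744, proof of `lem:anglefreepi`, with JPV's exact scalars): expand `H` by (EU)
(in the state-first form `rule_EU_state_first`), bend the red merge of the Euler gadget into the
cap (`hBox_par_wire_seq_cap`: the H-capped pair of wires is `(Z(π/2) ⊗ Z(π/2)) ⨾` a red
`X^{(3,0)}` fed by the green `-π/2` state), fuse the two `π/2` phases into the green node (total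
phase `π`, `Z_one_three_seq_phases`), disconnect the doubled wire between the green node and the red
node by the Hopf law (`hopf_transpose`, this consumes `√2 ⊗ √2`), and evaluate the remaining closed
piece `Z^{(0,1)}(-π/2) ⨾ X^{(1,0)}(0) = √2` by angle deletion.

## References

* E. Jeandel, S. Perdrix, R. Vilmart, LICS 2018 (arXiv:1705.11151v2), Appendix Lemma 9
  [JeandelPerdrixVilmart2018].
* M. Backens, S. Perdrix, Q. Wang, QPL 2016 (arXiv:1602.04744), App. A, Lemma `lem:anglefreepi`.
-/

noncomputable section

namespace Literature.Computability.QuantumComplexity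

open ZXDiagram ZXClass

namespace ZXClass

/-! ### Small plumbing lemmas -/

/-- A state slides past a `1 → 1` map under `⊗` and the crossing: `(A ⊗ s) ⨾ σ = s ⊗ A`. [folklore] -/
theorem par_state_seq_swap (A : ZXClass 1 1) (s : ZXClass 0 1) : (A ⊠ s) ⨟ mk swap = s ⊠ A := by
  have hn := congrArg (· ⨟ mk swap) (swap_nat s)
  simp only [bswap1_zero, bswap1_one, id_seq, seq_assoc, swap_seq_swap, seq_id] at hn
  -- `hn : s ⊠ 𝕀 = (𝕀 ⊗ s) ⨾ σ`
  calc (A ⊠ s) ⨟ mk swap = (A ⨟ (mk (wires 1) ⊠ s)) ⨟ mk swap := by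
          rw [par_eq_seq_left A s, par_empty]
    _ = A ⨟ (s ⊠ mk (wires 1)) := by rw [seq_assoc, ← hn]
    _ = s ⊠ A := by
          rw [par_eq_seq_right s A, empty_par, cast_id]

/-- A `1 → 2` map followed by a state next to a `2 → 1` map. [folklore] -/
theorem seq_state_par (A : ZXClass 1 2) (s : ZXClass 0 1) (B : ZXClass 2 1) :
    A ⨟ (s ⊠ B) = s ⊠ (A ⨟ B) := by
  have h := interchange (mk (wires 0)) s A B
  rw [id_seq, empty_par, cast_id] at h
  exact h

/-- A scalar slides inside a by-passing wire (arities `1 → 0` inside). [folklore] -/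
theorem scalar_par_wires_par_one_zero (t : ZXClass 0 0) (W : ZXClass 1 0) :
    t ⊠ (mk (wires 1) ⊠ W) = mk (wires 1) ⊠ (t ⊠ W) := by
  rw [par_assoc', cast_id, scalar_par_wires]
  exact (par_assoc _ _ _).trans (cast_id _ _ _)

/-- A scalar and a state commute under `⊗`. [folklore] -/
theorem scalar_par_state_comm (t : ZXClass 0 0) (s : ZXClass 0 1) : t ⊠ s = s ⊠ t := by
  rw [par_eq_seq_left t s, par_empty, empty_par, cast_id, par_eq_seq_right s t, empty_par, cast_id,
    par_empty]

/-- A scalar slides inside a state-carrying spatial composite (arities `1 → 1` inside). [folklore] -/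
theorem scalar_par_state_par (t : ZXClass 0 0) (s : ZXClass 0 1) (V : ZXClass 1 1) :
    t ⊠ (s ⊠ V) = s ⊠ (t ⊠ V) := by
  rw [par_assoc', cast_id, scalar_par_state_comm]
  exact (par_assoc _ _ _).trans (cast_id _ _ _)

/-- `√2` cancels on the left of `1 → 1` maps. [cite: JeandelPerdrixVilmart2018, Appendix Lemma 5] -/
theorem cancel_sqrt_two_left {Y Y' : ZXClass 1 1} (h : mk (dumbbell 0 0) ⊠ Y = mk (dumbbell 0 0) ⊠ Y') :
    Y = Y' := by
  have h' : mk invSqrtTwo ⊠ (mk (dumbbell 0 0) ⊠ Y) = mk invSqrtTwo ⊠ (mk (dumbbell 0 0) ⊠ Y') :=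
    congrArg (mk invSqrtTwo ⊠ ·) h
  rwa [par_assoc', cast_id, par_assoc', cast_id, invSqrtTwo_par_dumbbell, empty_par, cast_id, empty_par,
    cast_id] at h'

/-! ### (EU) with the state first; the Hadamard-capped pair of wires -/

/-- Rule (EU) with the `-π/2` state as the FIRST input of the red merge. [cite: JeandelPerdrixVilmart2018, Fig. 1 (EU)] -/
theorem rule_EU_state_first :
    mk hBox = ((mk (Z 0 1 (-2)) ⊠ mk (Z 1 1 2)) ⨟ mk (X 2 1 0)) ⨟ mk (Z 1 1 2) := by
  rw [rule_EU, ← par_state_seq_swap (mk (Z 1 1 2)) (mk (Z 0 1 (-2))),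
    seq_assoc (mk (Z 1 1 2) ⊠ mk (Z 0 1 (-2))) (mk swap) (mk (X 2 1 0)), swap_seq_X]

/-- **The Hadamard-capped pair of wires**: `(H ⊗ 𝕀) ⨾ ε = (Z(π/2) ⊗ Z(π/2)) ⨾ ((Z^{(0,1)}(-π/2) ⊗ 𝕀²)
⨾ X^{(3,0)})` ((EU), the phase slides around the cap, the red merge fuses with the cap).
[cite: JeandelPerdrixVilmart2018, Appendix Lemma 9] -/
theorem hBox_par_wire_seq_cap : (mk hBox ⊠ mk (wires 1)) ⨟ mk cap =
    (mk (Z 1 1 2) ⊠ mk (Z 1 1 2)) ⨟ ((mk (Z 0 1 (-2)) ⊠ mk (wires 2)) ⨟ mk (X 3 0 0)) := by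
  have hXcap : (mk (X 2 1 0) ⊠ mk (wires 1)) ⨟ mk cap = mk (X 3 0 0) := by
    rw [← X_two_zero, X_par_seq_X 2 1 1 0 le_rfl, add_zero (0 : ZMod 8)]
  have hs : (mk (Z 0 1 (-2)) ⊠ mk (Z 1 1 2)) ⊠ mk (Z 1 1 2) =
      (mk (Z 1 1 2) ⊠ mk (Z 1 1 2)) ⨟ (mk (Z 0 1 (-2)) ⊠ mk (wires 2)) :=
    ((par_assoc _ _ _).trans (cast_id _ _ _)).trans (by
      rw [par_eq_seq_right (mk (Z 0 1 (-2))) (mk (Z 1 1 2) ⊠ mk (Z 1 1 2)), empty_par, cast_id])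
  rw [rule_EU_state_first, seq_par_wires, seq_assoc, phase_par_seq_cap, ← par_phase_seq_cap, ← seq_assoc,
    interchange, seq_id, id_seq,
    show ((mk (Z 0 1 (-2)) ⊠ mk (Z 1 1 2)) ⨟ mk (X 2 1 0)) ⊠ mk (Z 1 1 2) =
      ((mk (Z 0 1 (-2)) ⊠ mk (Z 1 1 2)) ⊠ mk (Z 1 1 2)) ⨟ (mk (X 2 1 0) ⊠ mk (wires 1)) from by
        rw [interchange, seq_id],
    seq_assoc, hXcap, hs, seq_assoc]

/-! ### Two `π/2` phases on the looping legs -/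

/-- The two `π/2` phases of the expanded loop fuse into the green node: `Z^{(1,3)}(0) ⨾ (𝕀 ⊗ Z(π/2)
⊗ Z(π/2)) = Z^{(1,3)}(π)`. [cite: JeandelPerdrixVilmart2018, Fig. 1 (S1)] -/
theorem Z_one_three_seq_phases :
    mk (Z 1 3 0) ⨟ (mk (wires 1) ⊠ (mk (Z 1 1 2) ⊠ mk (Z 1 1 2))) = mk (Z 1 3 4) := by
  have h3 : mk (Z 1 3 0) = mk (Z 1 2 0) ⨟ (mk (wires 1) ⊠ mk (Z 1 2 0)) := by
    rw [Z_seq_par_Z 1 1 1 2 le_rfl, add_zero (0 : ZMod 8)]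
  have hinner : mk (Z 1 2 0) ⨟ (mk (Z 1 1 2) ⊠ mk (Z 1 1 2)) = mk (Z 1 2 4) := by
    rw [par_eq_seq_left (mk (Z 1 1 2)) (mk (Z 1 1 2)), ← seq_assoc, Z_seq_Z_par 1 1 1 1 le_rfl,
      Z_seq_par_Z 1 1 1 1 le_rfl, show (2 : ZMod 8) + 0 + 2 = 4 from by decide]
  rw [h3, seq_assoc, ← wires_par_seq, hinner, Z_seq_par_Z 1 1 1 2 le_rfl, zero_add (4 : ZMod 8)]

/-! ### The Hopf law upside down -/

/-- The Hopf law flipped: `√2 ⊗ √2 ⊗ (Z^{(1,2)} ⨾ X^{(2,1)}) = Z^{(1,0)} ⨾ X^{(0,1)}`. [cite: JeandelPerdrixVilmart2018, Appendix Lemma 3] -/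
theorem hopf_transpose : mk (dumbbell 0 0) ⊠ (mk (dumbbell 0 0) ⊠ (mk (Z 1 2 0) ⨟ mk (X 2 1 0))) =
    mk (Z 1 0 0) ⨟ mk (X 0 1 0) := by
  have h := congrArg transpose hopf
  simpa using h

/-! ### The closed piece left by the Hopf law -/

/-- After the Hopf law: `(Z^{(0,1)}(-π/2) ⊗ (Z^{(1,0)} ⨾ X^{(0,1)})) ⨾ X^{(2,0)} = Z^{(1,0)} ⨾ √2`
(red fusion and angle deletion at `-π/2`). [cite: JeandelPerdrixVilmart2018, Appendix Lemma 7] -/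
theorem state_par_effect_state_seq_X_cap :
    (mk (Z 0 1 (-2)) ⊠ (mk (Z 1 0 0) ⨟ mk (X 0 1 0))) ⨟ mk (X 2 0 0) = mk (Z 1 0 0) ⨟ mk (dumbbell 0 0) := by
  have h1 : mk (Z 0 1 (-2)) ⊠ (mk (Z 1 0 0) ⨟ mk (X 0 1 0)) = mk (Z 1 0 0) ⨟ (mk (Z 0 1 (-2)) ⊠ mk (X 0 1 0)) := by
    have h := interchange (mk (wires 0)) (mk (Z 0 1 (-2))) (mk (Z 1 0 0)) (mk (X 0 1 0))
    rw [id_seq, empty_par, cast_id] at h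
    exact h.symm
  have h2 : (mk (Z 0 1 (-2)) ⊠ mk (X 0 1 0)) ⨟ mk (X 2 0 0) = mk (dumbbell 0 0) := by
    rw [par_eq_seq_left (mk (Z 0 1 (-2))) (mk (X 0 1 0)), par_empty, seq_assoc,
      par_X_seq_X 1 0 1 0 le_rfl, add_zero (0 : ZMod 8), ← dumbbell_zero_neg_two, dumbbell_symm]
  rw [h1, seq_assoc, h2]

/-! ### The Hadamard loop -/

/-- **JPV Lemma 9 (the Hadamard loop)**: `√2 ⊗ (Z^{(1,3)}(0) ⨾ (𝕀 ⊗ ((H ⊗ 𝕀) ⨾ ε))) = Z^{(1,1)}(π)` —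
a phase-free green node on a wire, two of whose legs are joined through a Hadamard box, carries the
phase `π` up to the scalar `√2`. [cite: JeandelPerdrixVilmart2018, Appendix Lemma 9] -/
theorem sqrt_two_par_hLoop :
    mk (dumbbell 0 0) ⊠ (mk (Z 1 3 0) ⨟ (mk (wires 1) ⊠ ((mk hBox ⊠ mk (wires 1)) ⨟ mk cap))) =
      mk (Z 1 1 4) := by
  have hX : mk (X 3 0 0) = (mk (wires 1) ⊠ mk (X 2 1 0)) ⨟ mk (X 2 0 0) := by
    rw [par_X_seq_X 1 2 1 0 le_rfl, add_zero (0 : ZMod 8)]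
  have hZ : mk (Z 1 3 4) = mk (Z 1 1 4) ⨟ (mk (Z 1 2 0) ⨟ (mk (wires 1) ⊠ mk (Z 1 2 0))) := by
    rw [Z_seq_par_Z 1 1 1 2 le_rfl, add_zero (0 : ZMod 8), Z_seq_Z 1 1 3 le_rfl, add_zero (4 : ZMod 8)]
  -- the loop, redrawn: `Z(π) ⨾ Z^{(1,2)} ⨾ (𝕀 ⊗ ((s ⊗ (Z^{(1,2)} ⨾ X^{(2,1)})) ⨾ X^{(2,0)}))`
  have hshape : mk (Z 1 3 0) ⨟ (mk (wires 1) ⊠ ((mk hBox ⊠ mk (wires 1)) ⨟ mk cap)) =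
      mk (Z 1 1 4) ⨟ (mk (Z 1 2 0) ⨟ (mk (wires 1) ⊠
        ((mk (Z 0 1 (-2)) ⊠ (mk (Z 1 2 0) ⨟ mk (X 2 1 0))) ⨟ mk (X 2 0 0)))) := by
    rw [hBox_par_wire_seq_cap, wires_par_seq, ← seq_assoc, Z_one_three_seq_phases, hX, ← seq_assoc,
      ← par_eq_seq_left, hZ, seq_assoc, seq_assoc, ← wires_par_seq, ← seq_assoc (mk (Z 1 2 0)),
      seq_state_par]
  -- both `√2` travel to the doubled wire, the Hopf law disconnects it, the closed piece is `√2`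
  have key : mk (dumbbell 0 0) ⊠ (mk (dumbbell 0 0) ⊠
      (mk (Z 1 3 0) ⨟ (mk (wires 1) ⊠ ((mk hBox ⊠ mk (wires 1)) ⨟ mk cap)))) =
        mk (dumbbell 0 0) ⊠ mk (Z 1 1 4) := by
    rw [hshape, ← seq_scalar_par_one, ← seq_scalar_par_one, scalar_par_seq_right, empty_par, cast_id,
      scalar_par_seq_right, empty_par, cast_id, scalar_par_wires_par_one_zero,
      scalar_par_wires_par_one_zero, scalar_par_seq_left, empty_par, cast_id, scalar_par_seq_left,
      empty_par, cast_id, scalar_par_state_par, scalar_par_state_par, hopf_transpose,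
      state_par_effect_state_seq_X_cap, wires_par_seq, ← seq_assoc (mk (Z 1 2 0)),
      Z_seq_par_Z 1 1 1 0 le_rfl, add_zero (0 : ZMod 8), Z_one_one, id_seq, ← scalar_par_wires,
      seq_scalar_par_one, seq_id]
  exact cancel_sqrt_two_left key

/-- JPV's statement of Lemma 9: `Z^{(1,1)}(π)` equals the Hadamard loop next to the scalar
`Z^{(0,1)}(0) ⨾ X^{(1,0)}(0)`. [cite: JeandelPerdrixVilmart2018, Appendix Lemma 9] -/
theorem Z_phase_pi_eq_hLoop : mk (Z 1 1 4) =
    (mk (Z 1 3 0) ⨟ (mk (wires 1) ⊠ ((mk hBox ⊠ mk (wires 1)) ⨟ mk cap))) ⊠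
      (mk (Z 0 1 0) ⨟ mk (X 1 0 0)) := by
  rw [← dumbbell_zero_symm, ← scalar_par_wires', sqrt_two_par_hLoop]
where
  /-- `A ⊗ s = s ⊗ A` for a `1 → 1` map and a scalar. [folklore] -/
  scalar_par_wires' (A : ZXClass 1 1) (t : ZXClass 0 0) : t ⊠ A = A ⊠ t := by
    have h := swap_nat t
    simp only [bswap1_zero, seq_id, id_seq] at h
    calc t ⊠ A = (t ⊠ mk (wires 1)) ⨟ (mk (wires 0) ⊠ A) := by rw [par_eq_seq_left]
      _ = (mk (wires 1) ⊠ t) ⨟ (mk (wires 0) ⊠ A) := by rw [h]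
      _ = A ⊠ t := by rw [empty_par, cast_id, par_eq_seq_right A t, par_empty]

/-- **The green `π` state in phase-free form** (1602.04744, eq. (anglefreepidot)): `√2 ⊗ (Z^{(0,3)}(0) ⨾
(𝕀 ⊗ ((H ⊗ 𝕀) ⨾ ε))) = Z^{(0,1)}(π)` (plug the phase-free green state into the Hadamard loop).
[cite: JeandelPerdrixVilmart2018, Appendix Lemma 9] -/
theorem sqrt_two_par_hLoopState :
    mk (dumbbell 0 0) ⊠ (mk (Z 0 3 0) ⨟ (mk (wires 1) ⊠ ((mk hBox ⊠ mk (wires 1)) ⨟ mk cap))) =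
      mk (Z 0 1 4) := by
  have h : mk (Z 0 1 0) ⨟ (mk (dumbbell 0 0) ⊠ (mk (Z 1 3 0) ⨟ (mk (wires 1) ⊠ ((mk hBox ⊠ mk (wires 1)) ⨟
      mk cap)))) = mk (Z 0 1 0) ⨟ mk (Z 1 1 4) := congrArg (mk (Z 0 1 0) ⨟ ·) sqrt_two_par_hLoop
  rwa [state_seq_scalar_par, ← seq_assoc, Z_seq_Z 0 1 3 le_rfl, add_zero (0 : ZMod 8), Z_seq_Z 0 1 1 le_rfl,
    zero_add (4 : ZMod 8)] at h

/-- A green state next to a state on two wires, written with a by-passing wire. [folklore] -/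
theorem Z_state_seq_wires_par (a : ZMod 8) (B : ZXClass 0 2) :
    mk (Z 0 1 a) ⨟ (mk (wires 1) ⊠ B) = mk (Z 0 1 a) ⊠ B := by
  conv_lhs => rw [← par_empty (mk (Z 0 1 a)), interchange, seq_id, id_seq]

/-- **The green `π` state as a Hadamard cup closed by a green merge** (the bialgebra-ready form of
`sqrt_two_par_hLoopState`): `√2 ⊗ ((η ⨾ (H ⊗ 𝕀)) ⨾ Z^{(2,1)}(0)) = Z^{(0,1)}(π)`.
[cite: JeandelPerdrixVilmart2018, Appendix Lemma 9] -/
theorem sqrt_two_par_hCup_seq_Z_merge :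
    mk (dumbbell 0 0) ⊠ ((mk cup ⨟ (mk hBox ⊠ mk (wires 1))) ⨟ mk (Z 2 1 0)) = mk (Z 0 1 4) := by
  have ht := congrArg transpose sqrt_two_par_hLoop
  simp only [transpose_par, transpose_seq, transpose_mk, mk_transpose_dumbbell_zero, transpose_Z,
    transpose_wires, transpose_hBox, transpose_cap] at ht
  -- `ht : √2 ⊗ ((𝕀 ⊗ (η ⨾ (H ⊗ 𝕀))) ⨾ Z^{(3,1)}(0)) = Z^{(1,1)}(π)`; plug the phase-free green state
  have h : mk (Z 0 1 0) ⨟ (mk (dumbbell 0 0) ⊠ ((mk (wires 1) ⊠ (mk cup ⨟ (mk hBox ⊠ mk (wires 1)))) ⨟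
      mk (Z 3 1 0))) = mk (Z 0 1 0) ⨟ mk (Z 1 1 4) := congrArg (mk (Z 0 1 0) ⨟ ·) ht
  rwa [state_seq_scalar_par, ← seq_assoc, Z_state_seq_wires_par,
    par_eq_seq_right (mk (Z 0 1 0)) (mk cup ⨟ (mk hBox ⊠ mk (wires 1))), empty_par, cast_id, seq_assoc,
    Z_par_seq_Z 0 1 2 1 le_rfl, add_zero (0 : ZMod 8), Z_seq_Z 0 1 1 le_rfl, zero_add (4 : ZMod 8)] at h

end ZXClass

end Literature.Computability.QuantumComplexity


/-! ## Part: `ZXCalculusHTensor.lean` -/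
/-!
# `ZX_{π/4}` modulo the calculus: Hadamard tensors and colour change in usable form

Topic `Literature/Computability/QuantumComplexity`, continuing `ZXCalculusHLoop.lean` (layer A14 of
the formalisation of `JeandelPerdrixVilmart2018_completeness`): the colour-change rule (H) as a
CONVERSION of single spiders (the tool behind every "apply (H) to one node of a graph" step of the
stabiliser derivations, e.g. Backens–Perdrix–Wang's π-copy chain).

* `H^{⊗n}` modulo the calculus: small arities (`hTensor_one`, `hTensor_two`, `hTensor_three`), the
  involution `H^{⊗n} ⨾ H^{⊗n} = 𝕀ⁿ` (`hTensor_seq_hTensor`);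
* colour change solved for the spider: `X^{(n,m)}(a) = H^{⊗n} ⨾ Z^{(n,m)}(a) ⨾ H^{⊗m}` and
  `Z^{(n,m)}(a) = H^{⊗n} ⨾ X^{(n,m)}(a) ⨾ H^{⊗m}` (`X_eq_conj`, `Z_eq_conj`), with the small-arity
  instances used later (`X_split_eq`, `X_merge_eq`, `X_phase_eq`, `X_effect_eq`, …);
* a Hadamard box slides around a cap and a cup (`hBox_par_seq_cap_comm`, `cup_seq_hBox_par_comm`),
  and a phase moves through a Hadamard box changing colour (`Z_phase_seq_hBox`, `hBox_seq_Z_phase`).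

## References

* E. Jeandel, S. Perdrix, R. Vilmart, LICS 2018 (arXiv:1705.11151v2), Fig. 1 rule (H) and Appendix
  Lemma 8 [JeandelPerdrixVilmart2018].
* M. Backens, S. Perdrix, Q. Wang, QPL 2016 (arXiv:1602.04744), App. A, Lemma `hswap`.
-/

noncomputable section

namespace Literature.Computability.QuantumComplexity

open ZXDiagram ZXClass

namespace ZXClass

/-! ### Hadamard tensors -/

/-- `H^{⊗0}` is the empty diagram (definitional). [folklore] -/
@[simp] theorem hTensor_zero : mk (hTensor 0) = mk (wires 0) := rfl

/-- Unfolding `H^{⊗(n+1)} = H^{⊗n} ⊗ H` modulo the calculus. [folklore] -/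
theorem hTensor_succ (n : ℕ) : mk (hTensor (n + 1)) = mk (hTensor n) ⊠ mk hBox := rfl

/-- `H^{⊗1} = H` modulo the calculus. [folklore] -/
@[simp] theorem hTensor_one : mk (hTensor 1) = mk hBox := by
  rw [hTensor_succ, hTensor_zero, empty_par, cast_id]

/-- `H^{⊗2} = H ⊗ H` modulo the calculus. [folklore] -/
theorem hTensor_two : mk (hTensor 2) = mk hBox ⊠ mk hBox := by
  rw [hTensor_succ, hTensor_one]

/-- `H^{⊗3} = (H ⊗ H) ⊗ H` modulo the calculus. [folklore] -/
theorem hTensor_three : mk (hTensor 3) = (mk hBox ⊠ mk hBox) ⊠ mk hBox := by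
  rw [hTensor_succ, hTensor_two]

/-- **`H^{⊗n}` is an involution**: `H^{⊗n} ⨾ H^{⊗n} = 𝕀ⁿ`. [cite: JeandelPerdrixVilmart2018, Appendix Lemma 8] -/
@[simp] theorem hTensor_seq_hTensor : (n : ℕ) → mk (hTensor n) ⨟ mk (hTensor n) = mk (wires n)
  | 0 => by simp
  | n + 1 => by rw [hTensor_succ, interchange, hTensor_seq_hTensor n, hBox_seq_hBox, wires_par_wires]

/-! ### Colour change solved for the spider -/

/-- **Colour change, solved for the red spider**: `X^{(n,m)}(a) = H^{⊗n} ⨾ Z^{(n,m)}(a) ⨾ H^{⊗m}`.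
[cite: JeandelPerdrixVilmart2018, Fig. 1 (H)] -/
theorem X_eq_conj (n m : ℕ) (a : ZMod 8) :
    mk (X n m a) = mk (hTensor n) ⨟ mk (Z n m a) ⨟ mk (hTensor m) := by
  rw [← rule_H n m a, seq_assoc, seq_assoc, seq_assoc, hTensor_seq_hTensor, seq_id, ← seq_assoc,
    hTensor_seq_hTensor, id_seq]

/-- **Colour change, solved for the green spider**: `Z^{(n,m)}(a) = H^{⊗n} ⨾ X^{(n,m)}(a) ⨾ H^{⊗m}`.
[cite: JeandelPerdrixVilmart2018, Fig. 1 (H)] -/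
theorem Z_eq_conj (n m : ℕ) (a : ZMod 8) :
    mk (Z n m a) = mk (hTensor n) ⨟ mk (X n m a) ⨟ mk (hTensor m) := (rule_H n m a).symm

/-- The red split through Hadamard boxes: `X^{(1,2)}(a) = H ⨾ Z^{(1,2)}(a) ⨾ (H ⊗ H)`. [cite: JeandelPerdrixVilmart2018, Fig. 1 (H)] -/
theorem X_split_eq (a : ZMod 8) : mk (X 1 2 a) = mk hBox ⨟ mk (Z 1 2 a) ⨟ (mk hBox ⊠ mk hBox) := by
  rw [X_eq_conj, hTensor_one, hTensor_two]

/-- The red merge through Hadamard boxes: `X^{(2,1)}(a) = (H ⊗ H) ⨾ Z^{(2,1)}(a) ⨾ H`. [cite: JeandelPerdrixVilmart2018, Fig. 1 (H)] -/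
theorem X_merge_eq (a : ZMod 8) : mk (X 2 1 a) = (mk hBox ⊠ mk hBox) ⨟ mk (Z 2 1 a) ⨟ mk hBox := by
  rw [X_eq_conj, hTensor_one, hTensor_two]

/-- The red phase through Hadamard boxes: `X^{(1,1)}(a) = H ⨾ Z^{(1,1)}(a) ⨾ H`. [cite: JeandelPerdrixVilmart2018, Fig. 1 (H)] -/
theorem X_phase_eq (a : ZMod 8) : mk (X 1 1 a) = mk hBox ⨟ mk (Z 1 1 a) ⨟ mk hBox := by
  rw [X_eq_conj, hTensor_one]

/-- The green phase through Hadamard boxes: `Z^{(1,1)}(a) = H ⨾ X^{(1,1)}(a) ⨾ H`. [cite: JeandelPerdrixVilmart2018, Fig. 1 (H)] -/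
theorem Z_phase_eq (a : ZMod 8) : mk (Z 1 1 a) = mk hBox ⨟ mk (X 1 1 a) ⨟ mk hBox := by
  rw [Z_eq_conj, hTensor_one]

/-- The red effect: `X^{(1,0)}(a) = H ⨾ Z^{(1,0)}(a)`. [cite: JeandelPerdrixVilmart2018, Fig. 1 (H)] -/
theorem X_effect_eq (a : ZMod 8) : mk (X 1 0 a) = mk hBox ⨟ mk (Z 1 0 a) := by
  rw [X_eq_conj, hTensor_one, hTensor_zero, seq_id]

/-- The red state: `X^{(0,1)}(a) = Z^{(0,1)}(a) ⨾ H`. [cite: JeandelPerdrixVilmart2018, Fig. 1 (H)] -/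
theorem X_state_eq (a : ZMod 8) : mk (X 0 1 a) = mk (Z 0 1 a) ⨟ mk hBox := by
  rw [X_eq_conj, hTensor_one, hTensor_zero, id_seq]

/-- The red cap-spider: `X^{(2,0)}(a) = (H ⊗ H) ⨾ Z^{(2,0)}(a)`. [cite: JeandelPerdrixVilmart2018, Fig. 1 (H)] -/
theorem X_two_zero_eq (a : ZMod 8) : mk (X 2 0 a) = (mk hBox ⊠ mk hBox) ⨟ mk (Z 2 0 a) := by
  rw [X_eq_conj, hTensor_two, hTensor_zero, seq_id]

/-- The red three-legged effect: `X^{(3,0)}(a) = (H ⊗ H ⊗ H) ⨾ Z^{(3,0)}(a)`. [cite: JeandelPerdrixVilmart2018, Fig. 1 (H)] -/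
theorem X_three_zero_eq (a : ZMod 8) : mk (X 3 0 a) = ((mk hBox ⊠ mk hBox) ⊠ mk hBox) ⨟ mk (Z 3 0 a) := by
  rw [X_eq_conj, hTensor_three, hTensor_zero, seq_id]

/-! ### Phases through a Hadamard box; Hadamard boxes around cups and caps -/

/-- A green phase moves through a Hadamard box and turns red: `Z(a) ⨾ H = H ⨾ X(a)`. [cite: JeandelPerdrixVilmart2018, Fig. 1 (H)] -/
theorem Z_phase_seq_hBox (a : ZMod 8) : mk (Z 1 1 a) ⨟ mk hBox = mk hBox ⨟ mk (X 1 1 a) := by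
  rw [X_phase_eq, ← seq_assoc, ← seq_assoc, hBox_seq_hBox, id_seq]

/-- A red phase moves through a Hadamard box and turns green: `X(a) ⨾ H = H ⨾ Z(a)`. [cite: JeandelPerdrixVilmart2018, Fig. 1 (H)] -/
theorem X_phase_seq_hBox (a : ZMod 8) : mk (X 1 1 a) ⨟ mk hBox = mk hBox ⨟ mk (Z 1 1 a) := by
  rw [X_phase_eq, seq_assoc, seq_assoc, hBox_seq_hBox, seq_id]

/-- **A Hadamard box slides around a cap**: `(H ⊗ 𝕀) ⨾ ε = (𝕀 ⊗ H) ⨾ ε`. [cite: JeandelPerdrixVilmart2018, §2.2] -/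
theorem hBox_par_seq_cap_comm :
    (mk hBox ⊠ mk (wires 1)) ⨟ mk cap = (mk (wires 1) ⊠ mk hBox) ⨟ mk cap := by
  have h : mk cap = (mk hBox ⊠ mk hBox) ⨟ mk cap := by
    conv_lhs => rw [← X_two_zero, X_two_zero_eq, Z_two_zero]
  conv_lhs => rw [h, ← seq_assoc, interchange, hBox_seq_hBox, id_seq]

/-- **A Hadamard box slides around a cup**: `η ⨾ (H ⊗ 𝕀) = η ⨾ (𝕀 ⊗ H)`. [cite: JeandelPerdrixVilmart2018, §2.2] -/
theorem cup_seq_hBox_par_comm :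
    mk cup ⨟ (mk hBox ⊠ mk (wires 1)) = mk cup ⨟ (mk (wires 1) ⊠ mk hBox) := by
  have h := congrArg transpose hBox_par_seq_cap_comm
  simpa using h

/-- The cup with a Hadamard box on both legs is the cup: `η ⨾ (H ⊗ H) = η`. [cite: JeandelPerdrixVilmart2018, Fig. 1 (H)] -/
@[simp] theorem cup_seq_hBox_par_hBox : mk cup ⨟ (mk hBox ⊠ mk hBox) = mk cup := by
  conv_lhs => rw [← Z_zero_two, Z_eq_conj, hTensor_zero, id_seq, hTensor_two, seq_assoc, interchange,
    hBox_seq_hBox, wires_par_wires, seq_id, X_zero_two]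

/-- The cap with a Hadamard box on both legs is the cap: `(H ⊗ H) ⨾ ε = ε`. [cite: JeandelPerdrixVilmart2018, Fig. 1 (H)] -/
@[simp] theorem hBox_par_hBox_seq_cap : (mk hBox ⊠ mk hBox) ⨟ mk cap = mk cap := by
  have h := congrArg transpose cup_seq_hBox_par_hBox
  simp only [transpose_seq, transpose_par, transpose_mk, transpose_cup, transpose_hBox] at h
  exact h

end ZXClass

end Literature.Computability.QuantumComplexity


/-! ## Part: `ZXCalculusHadamardWires.lean` -/
/-!
# `ZX_{π/4}` modulo the calculus: Hadamard wires between green nodes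

Topic `Literature/Computability/QuantumComplexity`, continuing `ZXCalculusHTensor.lean` (layer A15
of the formalisation of `JeandelPerdrixVilmart2018_completeness`): the graph-like toolkit used to
derive the π-copy rule (K1) in `ZXCalculusPiCopy.lean`, and the first two steps of that derivation.

* plumbing: leg-bending of the green spider on the right (`split_par_seq_par_cap`,
  `par_cup_seq_merge_par`), the three-legged green state in its layouts, nested and crossed cups,
  scalars passing states of fixed arities, Hadamard boxes through crossings;
* **a parallel pair of wires, one of them through a Hadamard box, between two green nodes is a `π`
  phase** up to `√2` (`sqrt_two_par_split_par_hBox_merge`, Lemma 9 re-laid) and **two Hadamard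
  wires between two green nodes disconnect** with `√2 ⊗ √2` (`hopf_hBox`, the Hopf law after a
  colour change);
* Steps 1–2 of π-copy: for the Hadamard cup `P = η ⨾ (H ⊗ 𝕀) ⨾ Z^{(2,1)}` (so `√2 ⊗ P` is the green
  `π` state, Lemma 9), `P ⨾ X^{(1,2)}` rewritten by the bialgebra rule (B2) twice and the colour
  change rule (H) into two "columns" joined by one crossing (`hCup_merge_seq_X_split`,
  `Z_state_hBox_X_split_hBox_merges`), with the scalar `√2 ⊗ √2` in front.

## References

* E. Jeandel, S. Perdrix, R. Vilmart, LICS 2018 (arXiv:1705.11151v2), Fig. 1 and Appendix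
  Lemmas 3, 4, 9 [JeandelPerdrixVilmart2018].
* M. Backens, S. Perdrix, Q. Wang, *A simplified stabilizer ZX-calculus*, QPL 2016
  (arXiv:1602.04744), App. A, Lemma `pidotcopy` (whose bialgebra steps are followed here).
-/

noncomputable section

namespace Literature.Computability.QuantumComplexity

open ZXDiagram ZXClass

namespace ZXClass

/-! ### Plumbing: bends, scalars, Hadamard boxes past crossings -/

/-- Bending the second output of the green split into an input with a cap on the right:
`(Z^{(1,2)} ⊗ 𝕀) ⨾ (𝕀 ⊗ ε) = Z^{(2,1)}`. [cite: JeandelPerdrixVilmart2018, §2.2] -/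
theorem split_par_seq_par_cap : (mk (Z 1 2 0) ⊠ mk (wires 1)) ⨟ (mk (wires 1) ⊠ mk cap) = mk (Z 2 1 0) := by
  have h := fusion 1 1 1 0 1 le_rfl 0 0
  simpa [Z_two_zero] using h

/-- Bending the first input of the green merge into an output with a cup on the right:
`(𝕀 ⊗ η) ⨾ (Z^{(2,1)} ⊗ 𝕀) = Z^{(1,2)}`. [cite: JeandelPerdrixVilmart2018, §2.2] -/
theorem par_cup_seq_merge_par : (mk (wires 1) ⊠ mk cup) ⨟ (mk (Z 2 1 0) ⊠ mk (wires 1)) = mk (Z 1 2 0) := by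
  have h := congrArg transpose split_par_seq_par_cap
  simpa using h

/-- The phase-free green three-legged state, split on its first leg: `Z^{(0,3)} = η ⨾ (Z^{(1,2)} ⊗ 𝕀)`. [folklore] -/
theorem Z_zero_three_eq_cup_split_par : mk (Z 0 3 0) = mk cup ⨟ (mk (Z 1 2 0) ⊠ mk (wires 1)) := by
  rw [← Z_zero_two, Z_seq_Z_par 0 1 1 2 le_rfl, add_zero (0 : ZMod 8)]

/-- The phase-free green three-legged state, split on its last leg: `Z^{(0,3)} = η ⨾ (𝕀 ⊗ Z^{(1,2)})`. [folklore] -/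
theorem Z_zero_three_eq_cup_par_split : mk (Z 0 3 0) = mk cup ⨟ (mk (wires 1) ⊠ mk (Z 1 2 0)) := by
  rw [← Z_zero_two, Z_seq_par_Z 0 1 1 2 le_rfl, add_zero (0 : ZMod 8)]

/-- The green `3 → 1` spider as two merges, left first. [folklore] -/
theorem Z_three_one_eq_merge_par_merge : mk (Z 3 1 0) = (mk (Z 2 1 0) ⊠ mk (wires 1)) ⨟ mk (Z 2 1 0) := by
  rw [Z_par_seq_Z 2 1 1 1 le_rfl, add_zero (0 : ZMod 8)]

/-- The green `3 → 1` spider as two merges, right first. [folklore] -/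
theorem Z_three_one_eq_par_merge_merge : mk (Z 3 1 0) = (mk (wires 1) ⊠ mk (Z 2 1 0)) ⨟ mk (Z 2 1 0) := by
  rw [par_Z_seq_Z 1 2 1 1 le_rfl, add_zero (0 : ZMod 8)]

/-- Two nested cups whose two left legs are merged give the green three-legged state:
`η ⨾ (𝕀 ⊗ η ⊗ 𝕀) ⨾ (Z^{(2,1)} ⊗ 𝕀²) = Z^{(0,3)}`. [folklore] -/
theorem nested_cups_seq_merge :
    mk cup ⨟ ((mk (wires 1) ⊠ mk cup) ⊠ mk (wires 1)) ⨟ (mk (Z 2 1 0) ⊠ mk (wires 2)) = mk (Z 0 3 0) := by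
  have h2 : mk (Z 2 1 0) ⊠ mk (wires 2) = (mk (Z 2 1 0) ⊠ mk (wires 1)) ⊠ mk (wires 1) := by
    rw [← wires_par_wires 1 1]; exact (par_assoc' _ _ _).trans (cast_id _ _ _)
  rw [h2, seq_assoc, interchange, par_cup_seq_merge_par, seq_id, Z_zero_three_eq_cup_split_par]

/-- A Hadamard box at the top of the red split: `H ⨾ X^{(1,2)} = Z^{(1,2)} ⨾ (H ⊗ H)`. [cite: JeandelPerdrixVilmart2018, Fig. 1 (H)] -/
theorem hBox_seq_X_split : mk hBox ⨟ mk (X 1 2 0) = mk (Z 1 2 0) ⨟ (mk hBox ⊠ mk hBox) := by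
  rw [X_split_eq, ← seq_assoc, ← seq_assoc, hBox_seq_hBox, id_seq]

/-- Two Hadamard boxes slide through the crossing. [folklore] -/
theorem hBox_par_hBox_seq_swap : (mk hBox ⊠ mk hBox) ⨟ mk swap = mk swap ⨟ (mk hBox ⊠ mk hBox) := by
  have h1 : (mk hBox ⊠ mk (wires 1)) ⨟ mk swap = mk swap ⨟ (mk (wires 1) ⊠ mk hBox) := by
    simpa using swap_nat (mk hBox)
  have h2 : (mk (wires 1) ⊠ mk hBox) ⨟ mk swap = mk swap ⨟ (mk hBox ⊠ mk (wires 1)) := by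
    simpa using (fswap1_nat (mk hBox)).symm
  rw [par_eq_seq_left (mk hBox) (mk hBox), seq_assoc, h2, ← seq_assoc, h1, seq_assoc, ← par_eq_seq_left, ← par_eq_seq_right]

/-- A green state next to a green state, written with a by-passing wire. [folklore] -/
theorem Z_state_seq_wires_par_state (a b : ZMod 8) :
    mk (Z 0 1 a) ⨟ (mk (wires 1) ⊠ mk (Z 0 1 b)) = mk (Z 0 1 a) ⊠ mk (Z 0 1 b) := by
  conv_lhs => rw [← par_empty (mk (Z 0 1 a)), interchange, seq_id, id_seq]

/-- A scalar passes a state on two wires into the map after it. [folklore] -/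
theorem state_two_seq_scalar_par_two (A : ZXClass 0 2) (s : ZXClass 0 0) (B : ZXClass 2 2) :
    A ⨟ (s ⊠ B) = s ⊠ (A ⨟ B) := by
  rw [scalar_par_seq_right, empty_par, cast_id]

/-- A scalar passes a state on four wires into the map after it. [folklore] -/
theorem state_four_seq_scalar_par_four (A : ZXClass 0 4) (s : ZXClass 0 0) (B : ZXClass 4 4) :
    A ⨟ (s ⊠ B) = s ⊠ (A ⨟ B) := by
  rw [scalar_par_seq_right, empty_par, cast_id]

/-- A scalar attached to a state stays in front when a map is appended (one wire to two). [folklore] -/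
theorem scalar_par_state_one_seq_two (s : ZXClass 0 0) (A : ZXClass 0 1) (B : ZXClass 1 2) :
    (s ⊠ A) ⨟ B = s ⊠ (A ⨟ B) := by
  rw [scalar_par_seq_left, empty_par, cast_id]

/-- A scalar attached to a state stays in front when a map is appended (two wires to two). [folklore] -/
theorem scalar_par_state_two_seq_two (s : ZXClass 0 0) (A : ZXClass 0 2) (B : ZXClass 2 2) :
    (s ⊠ A) ⨟ B = s ⊠ (A ⨟ B) := by
  rw [scalar_par_seq_left, empty_par, cast_id]

/-- A scalar attached to a state stays in front when a map is appended (four wires to two). [folklore] -/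
theorem scalar_par_state_four_seq_two (s : ZXClass 0 0) (A : ZXClass 0 4) (B : ZXClass 4 2) :
    (s ⊠ A) ⨟ B = s ⊠ (A ⨟ B) := by
  rw [scalar_par_seq_left, empty_par, cast_id]

/-- A scalar and a state on two wires commute under `⊗`. [folklore] -/
theorem scalar_par_state_two_comm (t : ZXClass 0 0) (A : ZXClass 0 2) : t ⊠ A = A ⊠ t := by
  rw [par_eq_seq_left t A, par_empty, empty_par, cast_id, par_eq_seq_right A t, empty_par, cast_id,
    par_empty]

/-! ### A parallel pair of wires, one through a Hadamard box, is a `π` phase -/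

/-- **Lemma 9 re-laid**: a green split whose two outputs, one of them through a Hadamard box, enter
a green merge is the `π` phase up to `√2`: `√2 ⊗ (Z^{(1,2)} ⨾ (𝕀 ⊗ H) ⨾ Z^{(2,1)}) = Z^{(1,1)}(π)`.
[cite: JeandelPerdrixVilmart2018, Appendix Lemma 9] -/
theorem sqrt_two_par_split_par_hBox_merge :
    mk (dumbbell 0 0) ⊠ (mk (Z 1 2 0) ⨟ (mk (wires 1) ⊠ mk hBox) ⨟ mk (Z 2 1 0)) = mk (Z 1 1 4) := by
  have ht := congrArg transpose sqrt_two_par_hLoop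
  simp only [transpose_par, transpose_seq, transpose_mk, mk_transpose_dumbbell_zero, transpose_Z,
    transpose_wires, transpose_hBox, transpose_cap] at ht
  -- `ht : √2 ⊗ ((𝕀 ⊗ (η ⨾ (H ⊗ 𝕀))) ⨾ Z^{(3,1)}) = Z^{(1,1)}(π)`
  have h3 : mk (wires 1) ⊠ (mk (wires 1) ⊠ mk hBox) = mk (wires 2) ⊠ mk hBox := by
    rw [← wires_par_wires 1 1]; exact (par_assoc' _ _ _).trans (cast_id _ _ _)
  rw [cup_seq_hBox_par_comm, wires_par_seq, Z_three_one_eq_merge_par_merge, h3, seq_assoc,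
    ← seq_assoc (mk (wires 2) ⊠ mk hBox), ← slide, ← seq_assoc, ← seq_assoc, par_cup_seq_merge_par] at ht
  simpa using ht

/-- The mirror image: `√2 ⊗ (Z^{(1,2)} ⨾ (H ⊗ 𝕀) ⨾ Z^{(2,1)}) = Z^{(1,1)}(π)`. [cite: JeandelPerdrixVilmart2018, Appendix Lemma 9] -/
theorem sqrt_two_par_split_hBox_par_merge :
    mk (dumbbell 0 0) ⊠ (mk (Z 1 2 0) ⨟ (mk hBox ⊠ mk (wires 1)) ⨟ mk (Z 2 1 0)) = mk (Z 1 1 4) := by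
  rw [← sqrt_two_par_split_par_hBox_merge]
  congr 1
  have hs : mk swap ⨟ (mk hBox ⊠ mk (wires 1)) = (mk (wires 1) ⊠ mk hBox) ⨟ mk swap := by
    simpa using fswap1_nat (mk hBox)
  conv_lhs => rw [← Z_seq_swap 1 0, seq_assoc (mk (Z 1 2 0)), hs, ← seq_assoc, seq_assoc, swap_spider]

/-! ### The Hopf law for two Hadamard wires -/

/-- **Hopf law, Hadamard form**: two green nodes joined by two Hadamard wires disconnect:
`√2 ⊗ √2 ⊗ (Z^{(1,2)} ⨾ (H ⊗ H) ⨾ Z^{(2,1)}) = Z^{(1,0)} ⨾ Z^{(0,1)}`. [cite: JeandelPerdrixVilmart2018, Appendix Lemma 3] -/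
theorem hopf_hBox : mk (dumbbell 0 0) ⊠ (mk (dumbbell 0 0) ⊠ (mk (Z 1 2 0) ⨟ (mk hBox ⊠ mk hBox) ⨟ mk (Z 2 1 0))) =
    mk (Z 1 0 0) ⨟ mk (Z 0 1 0) := by
  rw [← hBox_seq_X_split, seq_assoc, ← seq_scalar_par_one, ← seq_scalar_par_one, hopf, ← seq_assoc,
    hBox_seq_X_effect]

/-- The same with the splitting node a state on one more wire:
`√2 ⊗ √2 ⊗ (Z^{(0,3)} ⨾ (𝕀 ⊗ ((H ⊗ H) ⨾ Z^{(2,1)}))) = Z^{(0,1)} ⊗ Z^{(0,1)}`. [cite: JeandelPerdrixVilmart2018, Appendix Lemma 3] -/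
theorem hopf_hBox_state : mk (dumbbell 0 0) ⊠ (mk (dumbbell 0 0) ⊠
    (mk (Z 0 3 0) ⨟ (mk (wires 1) ⊠ ((mk hBox ⊠ mk hBox) ⨟ mk (Z 2 1 0))))) = mk (Z 0 1 0) ⊠ mk (Z 0 1 0) := by
  rw [Z_zero_three_eq_cup_par_split, seq_assoc, ← wires_par_seq, ← seq_assoc, ← state_two_seq_scalar_par_two,
    ← state_two_seq_scalar_par_two, scalar_par_wires_par_one, scalar_par_wires_par_one, hopf_hBox,
    wires_par_seq, ← seq_assoc, cup_seq_par_effect, Z_state_seq_wires_par_state]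

/-! ### Step 1: the first bialgebra, re-laid symmetrically

`P ⨾ X^{(1,2)} = √2 ⊗ (Z^{(0,3)} ⨾ (H ⊗ X^{(1,2)} ⊗ H) ⨾ (Z^{(2,1)} ⊗ Z^{(2,1)}))` for the Hadamard
cup `P = η ⨾ (H ⊗ 𝕀) ⨾ Z^{(2,1)}` (so that `√2 ⊗ P = Z^{(0,1)}(π)`). -/

/-- The phase-free green three-legged state is symmetric in its last two legs. [cite: JeandelPerdrixVilmart2018, §2.2] -/
theorem Z_zero_three_seq_par_swap : mk (Z 0 3 0) ⨟ (mk (wires 1) ⊠ mk swap) = mk (Z 0 3 0) := by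
  rw [Z_zero_three_eq_cup_par_split, seq_assoc, ← wires_par_seq, Z_seq_swap]

/-- The crossing followed by `H ⊗ X^{(1,2)}`: naturality. [folklore] -/
theorem swap_seq_hBox_par_X_split :
    mk swap ⨟ (mk hBox ⊠ mk (X 1 2 0)) = (mk (X 1 2 0) ⊠ mk hBox) ⨟ mk (bswap1 2) := by
  have hs : mk swap ⨟ (mk hBox ⊠ mk (wires 1)) = (mk (wires 1) ⊠ mk hBox) ⨟ mk swap := by
    simpa using fswap1_nat (mk hBox)
  have hn : mk swap ⨟ (mk (wires 1) ⊠ mk (X 1 2 0)) = (mk (X 1 2 0) ⊠ mk (wires 1)) ⨟ mk (bswap1 2) := by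
    simpa using (swap_nat (mk (X 1 2 0))).symm
  rw [par_eq_seq_left (mk hBox) (mk (X 1 2 0)), ← seq_assoc, hs, seq_assoc, hn, ← seq_assoc,
    ← par_eq_seq_right]

/-- The permutation bookkeeping of Step 1, first half. [folklore] -/
theorem par_swap_seq_hBox_par_hBox_par_X_split :
    (mk (wires 1) ⊠ mk swap) ⨟ ((mk hBox ⊠ mk hBox) ⊠ mk (X 1 2 0)) =
      ((mk hBox ⊠ mk (X 1 2 0)) ⊠ mk hBox) ⨟ (mk (wires 1) ⊠ mk (bswap1 2)) := by
  have e1 : (mk hBox ⊠ mk hBox) ⊠ mk (X 1 2 0) = mk hBox ⊠ (mk hBox ⊠ mk (X 1 2 0)) :=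
    (par_assoc _ _ _).trans (cast_id _ _ _)
  have e2 : (mk hBox ⊠ mk (X 1 2 0)) ⊠ mk hBox = mk hBox ⊠ (mk (X 1 2 0) ⊠ mk hBox) :=
    (par_assoc _ _ _).trans (cast_id _ _ _)
  rw [e1, interchange, id_seq, swap_seq_hBox_par_X_split, e2, interchange, seq_id]

/-- The permutation bookkeeping of Step 1, second half: the two crossings cancel up to the
commutativity of the green merge. [folklore] -/
theorem par_bswap1_seq_swap_seq_merges :
    ((mk (wires 1) ⊠ mk (bswap1 2)) ⨟ ((mk (wires 1) ⊠ mk swap) ⊠ mk (wires 1))) ⨟ (mk (Z 2 1 0) ⊠ mk (Z 2 1 0)) =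
      mk (Z 2 1 0) ⊠ mk (Z 2 1 0) := by
  have e3 : mk (wires 1) ⊠ (mk swap ⊠ mk (wires 1)) = (mk (wires 1) ⊠ mk swap) ⊠ mk (wires 1) :=
    (par_assoc' _ _ _).trans (cast_id _ _ _)
  have e4 : mk (wires 1) ⊠ (mk (wires 1) ⊠ mk swap) = mk (wires 2) ⊠ mk swap := by
    rw [← wires_par_wires 1 1]; exact (par_assoc' _ _ _).trans (cast_id _ _ _)
  have hsq : ((mk (wires 1) ⊠ mk swap) ⊠ mk (wires 1)) ⨟ ((mk (wires 1) ⊠ mk swap) ⊠ mk (wires 1)) = mk (wires 4) := by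
    rw [interchange, interchange, id_seq, swap_seq_swap, wires_par_wires, wires_par_wires]
  rw [bswap1_two, wires_par_seq, e3, e4, seq_assoc (mk (wires 2) ⊠ mk swap), hsq, seq_id, interchange, id_seq,
    swap_spider]

/-- **Step 1**: the Hadamard cup closed by a green merge, then the red split — bialgebra (B2) once,
colour change of the red node under the Hadamard box, and the green three-legged state re-laid
with the red split on its middle leg. [cite: JeandelPerdrixVilmart2018, Appendix Lemma 4] -/
theorem hCup_merge_seq_X_split :
    ((mk cup ⨟ (mk hBox ⊠ mk (wires 1))) ⨟ mk (Z 2 1 0)) ⨟ mk (X 1 2 0) =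
      mk (dumbbell 0 0) ⊠ (mk (Z 0 3 0) ⨟ ((mk hBox ⊠ mk (X 1 2 0)) ⊠ mk hBox) ⨟ (mk (Z 2 1 0) ⊠ mk (Z 2 1 0))) := by
  have hC : (mk (Z 1 2 0) ⨟ (mk hBox ⊠ mk hBox)) ⊠ mk (X 1 2 0) =
      (mk (Z 1 2 0) ⊠ mk (X 1 2 0)) ⨟ ((mk hBox ⊠ mk hBox) ⊠ mk (wires 2)) := by
    rw [interchange, seq_id]
  have hD : mk cup ⨟ (mk (Z 1 2 0) ⊠ mk (X 1 2 0)) = mk (Z 0 3 0) ⨟ (mk (wires 2) ⊠ mk (X 1 2 0)) := by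
    rw [par_eq_seq_left, ← seq_assoc, ← Z_zero_three_eq_cup_split_par]
  rw [seq_assoc, ← rule_B2_red, state_two_seq_scalar_par_two]
  congr 1
  rw [← seq_assoc, ← seq_assoc, seq_assoc (mk cup), interchange (mk hBox) (mk (X 1 2 0)) (mk (wires 1)) (mk (X 1 2 0)),
    id_seq, hBox_seq_X_split, hC, ← seq_assoc (mk cup), hD, seq_assoc (mk (Z 0 3 0)), ← slide, ← par_eq_seq_left]
  conv_lhs => rw [← Z_zero_three_seq_par_swap]
  rw [seq_assoc (mk (Z 0 3 0)), par_swap_seq_hBox_par_hBox_par_X_split, ← seq_assoc (mk (Z 0 3 0)),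
    seq_assoc _ (mk (wires 1) ⊠ mk (bswap1 2)), seq_assoc _ ((mk (wires 1) ⊠ mk (bswap1 2)) ⨟ _),
    par_bswap1_seq_swap_seq_merges]

/-! ### Step 2: the second bialgebra; the two columns

With `Lcol := η ⨾ ((Z^{(1,2)} ⨾ (𝕀 ⊗ H) ⨾ Z^{(2,1)}) ⊗ H)` and `Rcol := η ⨾ (H ⊗ (Z^{(1,2)} ⨾ (H ⊗ 𝕀) ⨾ Z^{(2,1)}))`:
`Z^{(0,3)} ⨾ (H ⊗ X^{(1,2)} ⊗ H) ⨾ (Z^{(2,1)} ⊗ Z^{(2,1)}) = √2 ⊗ ((Lcol ⊗ Rcol) ⨾ (𝕀 ⊗ σ ⊗ 𝕀) ⨾ (Z^{(2,1)} ⊗ Z^{(2,1)}))`. -/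

/-- Two cups with their inner legs merged: `(η ⊗ η) ⨾ (𝕀 ⊗ Z^{(2,1)} ⊗ 𝕀) = Z^{(0,3)}`. [folklore] -/
theorem cups_seq_par_merge_par : (mk cup ⊠ mk cup) ⨟ ((mk (wires 1) ⊠ mk (Z 2 1 0)) ⊠ mk (wires 1)) = mk (Z 0 3 0) := by
  have e : mk cup ⊠ mk (wires 2) = (mk cup ⊠ mk (wires 1)) ⊠ mk (wires 1) := by
    rw [← wires_par_wires 1 1]; exact (par_assoc' _ _ _).trans (cast_id _ _ _)
  rw [par_eq_seq_right (mk cup) (mk cup), seq_assoc, e, interchange, spider_bend, id_seq, empty_par, cast_id,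
    ← Z_zero_three_eq_cup_split_par]

/-- A scalar and a `1 → 1` map commute under `⊗`. [folklore] -/
theorem scalar_par_one_comm (t : ZXClass 0 0) (A : ZXClass 1 1) : t ⊠ A = A ⊠ t := by
  have h := swap_nat t
  simp only [bswap1_zero, seq_id, id_seq] at h
  calc t ⊠ A = (t ⊠ mk (wires 1)) ⨟ (mk (wires 0) ⊠ A) := by rw [par_eq_seq_left]
    _ = (mk (wires 1) ⊠ t) ⨟ (mk (wires 0) ⊠ A) := by rw [h]
    _ = A ⊠ t := by rw [empty_par, cast_id, par_eq_seq_right A t, par_empty]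

/-- A scalar in the middle of `H ⊗ · ⊗ H` comes out in front. [folklore] -/
theorem hBox_par_scalar_par_par_hBox (s : ZXClass 0 0) (E : ZXClass 2 2) :
    (mk hBox ⊠ (s ⊠ E)) ⊠ mk hBox = s ⊠ ((mk hBox ⊠ E) ⊠ mk hBox) := by
  have e1 : mk hBox ⊠ (s ⊠ E) = (mk hBox ⊠ s) ⊠ E := (par_assoc' _ _ _).trans (cast_id _ _ _)
  have e2 : (s ⊠ mk hBox) ⊠ E = s ⊠ (mk hBox ⊠ E) := (par_assoc _ _ _).trans (cast_id _ _ _)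
  rw [e1, ← scalar_par_one_comm, e2]
  exact (par_assoc _ _ _).trans (cast_id _ _ _)

/-- Splitting `A ⊗ (E₁ ⨾ E₂ ⨾ E₃) ⊗ C` into three layers. [folklore] -/
theorem one_par_seq_seq_par_one (A C : ZXClass 1 1) (E₁ : ZXClass 2 4) (E₂ : ZXClass 4 4) (E₃ : ZXClass 4 2) :
    (A ⊠ (E₁ ⨟ E₂ ⨟ E₃)) ⊠ C =
      ((A ⊠ E₁) ⊠ C) ⨟ ((mk (wires 1) ⊠ E₂) ⊠ mk (wires 1)) ⨟ ((mk (wires 1) ⊠ E₃) ⊠ mk (wires 1)) := by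
  rw [interchange, interchange, interchange, interchange]
  simp only [seq_id]

/-- The left column: the cup feeding `H ⊗ X^{(1,2)}`, with the red node colour-changed and the green
nodes fused, is `η ⨾ ((Z^{(1,2)} ⨾ (𝕀 ⊗ H)) ⊗ H)`. [cite: JeandelPerdrixVilmart2018, Fig. 1 (H), (S1)] -/
theorem cup_seq_hBox_par_X_split :
    mk cup ⨟ (mk hBox ⊠ mk (X 1 2 0)) = mk cup ⨟ ((mk (Z 1 2 0) ⨟ (mk (wires 1) ⊠ mk hBox)) ⊠ mk hBox) := by
  have e6 : mk (wires 1) ⊠ (mk hBox ⊠ mk hBox) = (mk (wires 1) ⊠ mk hBox) ⊠ mk hBox :=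
    (par_assoc' _ _ _).trans (cast_id _ _ _)
  rw [par_eq_seq_left (mk hBox) (mk (X 1 2 0)), ← seq_assoc, cup_seq_hBox_par_comm, seq_assoc, ← wires_par_seq,
    hBox_seq_X_split, wires_par_seq, ← seq_assoc, ← Z_zero_three_eq_cup_par_split, Z_zero_three_eq_cup_split_par,
    e6, seq_assoc, interchange, id_seq]

/-- The right column, mirror image. [cite: JeandelPerdrixVilmart2018, Fig. 1 (H), (S1)] -/
theorem cup_seq_X_split_par_hBox :
    mk cup ⨟ (mk (X 1 2 0) ⊠ mk hBox) = mk cup ⨟ (mk hBox ⊠ (mk (Z 1 2 0) ⨟ (mk hBox ⊠ mk (wires 1)))) := by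
  have e7 : (mk hBox ⊠ mk hBox) ⊠ mk (wires 1) = mk hBox ⊠ (mk hBox ⊠ mk (wires 1)) :=
    (par_assoc _ _ _).trans (cast_id _ _ _)
  rw [par_eq_seq_right (mk (X 1 2 0)) (mk hBox), ← seq_assoc, ← cup_seq_hBox_par_comm, seq_assoc, ← seq_par_wires,
    hBox_seq_X_split, seq_par_wires, ← seq_assoc, ← Z_zero_three_eq_cup_split_par, Z_zero_three_eq_cup_par_split,
    e7, seq_assoc, interchange, id_seq]

/-- The bottom half of Step 2: the two cups feeding `H ⊗ X^{(1,2)} ⊗ X^{(1,2)} ⊗ H` are the two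
columns' bottoms side by side. [cite: JeandelPerdrixVilmart2018, Fig. 1 (H), (S1)] -/
theorem cups_seq_hBox_par_X_splits_par_hBox :
    (mk cup ⊠ mk cup) ⨟ ((mk hBox ⊠ (mk (X 1 2 0) ⊠ mk (X 1 2 0))) ⊠ mk hBox) =
      (mk cup ⨟ ((mk (Z 1 2 0) ⨟ (mk (wires 1) ⊠ mk hBox)) ⊠ mk hBox)) ⊠
        (mk cup ⨟ (mk hBox ⊠ (mk (Z 1 2 0) ⨟ (mk hBox ⊠ mk (wires 1))))) := by
  have e5 : (mk hBox ⊠ (mk (X 1 2 0) ⊠ mk (X 1 2 0))) ⊠ mk hBox = (mk hBox ⊠ mk (X 1 2 0)) ⊠ (mk (X 1 2 0) ⊠ mk hBox) := by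
    rw [show mk hBox ⊠ (mk (X 1 2 0) ⊠ mk (X 1 2 0)) = (mk hBox ⊠ mk (X 1 2 0)) ⊠ mk (X 1 2 0) from
      (par_assoc' _ _ _).trans (cast_id _ _ _)]
    exact (par_assoc _ _ _).trans (cast_id _ _ _)
  rw [e5, interchange, cup_seq_hBox_par_X_split, cup_seq_X_split_par_hBox]

/-- The top half of Step 2: the inner and outer merges are two `Z^{(3,1)}`, re-split the other way.
[cite: JeandelPerdrixVilmart2018, Fig. 1 (S1)] -/
theorem par_merges_par_seq_merges :
    ((mk (wires 1) ⊠ (mk (Z 2 1 0) ⊠ mk (Z 2 1 0))) ⊠ mk (wires 1)) ⨟ (mk (Z 2 1 0) ⊠ mk (Z 2 1 0)) =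
      ((mk (Z 2 1 0) ⊠ mk (wires 1)) ⊠ (mk (wires 1) ⊠ mk (Z 2 1 0))) ⨟ (mk (Z 2 1 0) ⊠ mk (Z 2 1 0)) := by
  have e8 : (mk (wires 1) ⊠ (mk (Z 2 1 0) ⊠ mk (Z 2 1 0))) ⊠ mk (wires 1) =
      (mk (wires 1) ⊠ mk (Z 2 1 0)) ⊠ (mk (Z 2 1 0) ⊠ mk (wires 1)) := by
    rw [show mk (wires 1) ⊠ (mk (Z 2 1 0) ⊠ mk (Z 2 1 0)) = (mk (wires 1) ⊠ mk (Z 2 1 0)) ⊠ mk (Z 2 1 0) from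
      (par_assoc' _ _ _).trans (cast_id _ _ _)]
    exact (par_assoc _ _ _).trans (cast_id _ _ _)
  rw [e8, interchange, interchange, ← Z_three_one_eq_par_merge_merge, ← Z_three_one_eq_merge_par_merge]

/-- The crossing of the two middle wires commutes with the two outer merges. [folklore] -/
theorem par_swap_par_seq_merge_par_par_merge :
    ((mk (wires 1) ⊠ ((mk (wires 1) ⊠ mk swap) ⊠ mk (wires 1))) ⊠ mk (wires 1)) ⨟
        ((mk (Z 2 1 0) ⊠ mk (wires 1)) ⊠ (mk (wires 1) ⊠ mk (Z 2 1 0))) =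
      ((mk (Z 2 1 0) ⊠ mk (wires 1)) ⊠ (mk (wires 1) ⊠ mk (Z 2 1 0))) ⨟ ((mk (wires 1) ⊠ mk swap) ⊠ mk (wires 1)) := by
  have e9a : (mk (wires 1) ⊠ mk swap) ⊠ mk (wires 1) = mk (wires 1) ⊠ (mk swap ⊠ mk (wires 1)) :=
    (par_assoc _ _ _).trans (cast_id _ _ _)
  have e9b : (mk (wires 1) ⊠ (mk (wires 1) ⊠ (mk swap ⊠ mk (wires 1)))) ⊠ mk (wires 1) =
      mk (wires 1) ⊠ ((mk (wires 1) ⊠ (mk swap ⊠ mk (wires 1))) ⊠ mk (wires 1)) := (par_assoc _ _ _).trans (cast_id _ _ _)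
  have e9c : (mk (wires 1) ⊠ (mk swap ⊠ mk (wires 1))) ⊠ mk (wires 1) = mk (wires 1) ⊠ (mk swap ⊠ mk (wires 2)) := by
    rw [← wires_par_wires 1 1, show mk swap ⊠ (mk (wires 1) ⊠ mk (wires 1)) = (mk swap ⊠ mk (wires 1)) ⊠ mk (wires 1)
      from (par_assoc' _ _ _).trans (cast_id _ _ _)]
    exact (par_assoc _ _ _).trans (cast_id _ _ _)
  have e9d : mk (wires 1) ⊠ (mk (wires 1) ⊠ (mk swap ⊠ mk (wires 2))) = mk (wires 2) ⊠ (mk swap ⊠ mk (wires 2)) := by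
    rw [← wires_par_wires 1 1]; exact (par_assoc' _ _ _).trans (cast_id _ _ _)
  have e10 : (mk (Z 2 1 0) ⊠ mk (wires 1)) ⊠ (mk (wires 1) ⊠ mk (Z 2 1 0)) = mk (Z 2 1 0) ⊠ (mk (wires 2) ⊠ mk (Z 2 1 0)) := by
    rw [← wires_par_wires 1 1, show mk (wires 1) ⊠ mk (wires 1) ⊠ mk (Z 2 1 0) = mk (wires 1) ⊠ (mk (wires 1) ⊠ mk (Z 2 1 0))
      from (par_assoc _ _ _).trans (cast_id _ _ _)]
    exact (par_assoc _ _ _).trans (cast_id _ _ _)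
  rw [e9a, e9b, e9c, e9d, e10, interchange, id_seq, ← par_eq_seq_left, interchange, seq_id, ← par_eq_seq_right]

/-- **Step 2**: bialgebra (B2) on the middle leg, colour change of both red nodes it creates (the
Hadamard boxes of the outer legs having slid round the cups), fusion of the green nodes into two
columns joined by one crossing. [cite: JeandelPerdrixVilmart2018, Appendix Lemma 4] -/
theorem Z_state_hBox_X_split_hBox_merges :
    mk (Z 0 3 0) ⨟ ((mk hBox ⊠ mk (X 1 2 0)) ⊠ mk hBox) ⨟ (mk (Z 2 1 0) ⊠ mk (Z 2 1 0)) =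
      mk (dumbbell 0 0) ⊠ ((
        (mk cup ⨟ ((mk (Z 1 2 0) ⨟ (mk (wires 1) ⊠ mk hBox) ⨟ mk (Z 2 1 0)) ⊠ mk hBox)) ⊠
        (mk cup ⨟ (mk hBox ⊠ (mk (Z 1 2 0) ⨟ (mk hBox ⊠ mk (wires 1)) ⨟ mk (Z 2 1 0))))) ⨟
          ((mk (wires 1) ⊠ mk swap) ⊠ mk (wires 1)) ⨟ (mk (Z 2 1 0) ⊠ mk (Z 2 1 0))) := by
  rw [← cups_seq_par_merge_par, seq_assoc (mk cup ⊠ mk cup), interchange, interchange, id_seq,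
    ← rule_B2_red, hBox_par_scalar_par_par_hBox, state_four_seq_scalar_par_four, scalar_par_state_four_seq_two]
  congr 1
  rw [one_par_seq_seq_par_one, ← seq_assoc, ← seq_assoc, seq_assoc _ ((mk (wires 1) ⊠ (mk (Z 2 1 0) ⊠ mk (Z 2 1 0))) ⊠ mk (wires 1)),
    par_merges_par_seq_merges, cups_seq_hBox_par_X_splits_par_hBox, ← seq_assoc,
    seq_assoc _ ((mk (wires 1) ⊠ ((mk (wires 1) ⊠ mk swap) ⊠ mk (wires 1))) ⊠ mk (wires 1)),
    par_swap_par_seq_merge_par_par_merge, ← seq_assoc _ ((mk (Z 2 1 0) ⊠ mk (wires 1)) ⊠ (mk (wires 1) ⊠ mk (Z 2 1 0))),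
    interchange (mk cup ⨟ _) (mk (Z 2 1 0) ⊠ mk (wires 1)), seq_assoc (mk cup), seq_assoc (mk cup), interchange,
    interchange, seq_id]

end ZXClass

end Literature.Computability.QuantumComplexity


/-! ## Part: `ZXCalculusPiCopy.lean` -/
/-!
# `ZX_{π/4}` modulo the calculus: the green `π` state is copied by the red spider (π-copy, K1)

Topic `Literature/Computability/QuantumComplexity`, continuing `ZXCalculusHadamardWires.lean`
(layer A16 of the formalisation of `JeandelPerdrixVilmart2018_completeness`).

* **π-copy for states** (`pidotcopy`): `√2 ⊗ (Z^{(0,1)}(π) ⨾ X^{(1,2)}) = Z^{(0,1)}(π) ⊗ Z^{(0,1)}(π)`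
  — Backens–Perdrix–Wang's Lemma `pidotcopy`, the heart of the derivability of the π-copy rule
  (K1) in the stabiliser ZX-calculus, here inside JPV's axiomatisation with exact scalars;
* **JPV Lemma 4 = (K1)** (`K1`): `Z^{(1,1)}(π) ⨾ X^{(1,2)} = X^{(1,2)} ⨾ (Z^{(1,1)}(π) ⊗ Z^{(1,1)}(π))`,
  one of the lemmas JPV obtain "by completeness of the π/2-fragment", derived here in the term
  calculus.

Derivation of `pidotcopy` (ours; the cited one is a twelve-diagram graphical chain): write the
`π` state in phase-free form `√2 ⊗ (η ⨾ (H ⊗ 𝕀) ⨾ Z^{(2,1)})` (Lemma 9), apply the bialgebra rule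
(B2) twice and the colour-change rule (H) to the red nodes it creates (Steps 1–2, in
`ZXCalculusHadamardWires.lean`); the Hadamard boxes then sit on two PARALLEL pairs of wires
between green nodes, which Lemma 9 (read backwards) turns into two `π` phases (Step 3), and on one
ANTIPARALLEL pair — two crossed Hadamard cups — which the Hopf law disconnects (Step 4). (K1)
follows from `pidotcopy` by one more use of (B2) and (S1).

## References

* E. Jeandel, S. Perdrix, R. Vilmart, LICS 2018 (arXiv:1705.11151v2), Appendix Lemma 4
  [JeandelPerdrixVilmart2018].
* M. Backens, S. Perdrix, Q. Wang, *A simplified stabilizer ZX-calculus*, QPL 2016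
  (arXiv:1602.04744), App. A, Lemmas `pidotcopy` and `K1`.
-/

noncomputable section

namespace Literature.Computability.QuantumComplexity

open ZXDiagram ZXClass

namespace ZXClass

/-! ### Step 3: the parallel pairs become `π` phases -/

/-- A scalar attached to a state on four wires stays in front when a map is appended (four to four). [folklore] -/
theorem scalar_par_state_four_seq_four (s : ZXClass 0 0) (A : ZXClass 0 4) (B : ZXClass 4 4) :
    (s ⊠ A) ⨟ B = s ⊠ (A ⨟ B) := by
  rw [scalar_par_seq_left, empty_par, cast_id]

/-- The two `π` phases on the outer wires fuse into the merges and come out on top. [cite: JeandelPerdrixVilmart2018, Fig. 1 (S1)] -/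
theorem phases_par_seq_merges :
    ((mk (Z 1 1 4) ⊠ mk (wires 2)) ⊠ mk (Z 1 1 4)) ⨟ (mk (Z 2 1 0) ⊠ mk (Z 2 1 0)) =
      (mk (Z 2 1 0) ⊠ mk (Z 2 1 0)) ⨟ (mk (Z 1 1 4) ⊠ mk (Z 1 1 4)) := by
  have e13 : (mk (Z 1 1 4) ⊠ mk (wires 2)) ⊠ mk (Z 1 1 4) = (mk (Z 1 1 4) ⊠ mk (wires 1)) ⊠ (mk (wires 1) ⊠ mk (Z 1 1 4)) := by
    rw [← wires_par_wires 1 1, show mk (Z 1 1 4) ⊠ (mk (wires 1) ⊠ mk (wires 1)) = (mk (Z 1 1 4) ⊠ mk (wires 1)) ⊠ mk (wires 1)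
      from (par_assoc' _ _ _).trans (cast_id _ _ _)]
    exact (par_assoc _ _ _).trans (cast_id _ _ _)
  rw [e13, interchange, Z_par_seq_Z 1 1 1 1 le_rfl, par_Z_seq_Z 1 1 1 1 le_rfl, add_zero (4 : ZMod 8), zero_add (4 : ZMod 8),
    interchange, Z_seq_Z 2 1 1 le_rfl, zero_add (4 : ZMod 8)]

/-- The `π`/Hadamard layer followed by the crossing, re-layered: crossing and Hadamard boxes first,
phases on top. [folklore] -/
theorem phase_hBoxes_phase_seq_par_swap_par :
    ((mk (Z 1 1 4) ⊠ (mk hBox ⊠ mk hBox)) ⊠ mk (Z 1 1 4)) ⨟ ((mk (wires 1) ⊠ mk swap) ⊠ mk (wires 1)) =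
      ((mk (wires 1) ⊠ ((mk hBox ⊠ mk hBox) ⨟ mk swap)) ⊠ mk (wires 1)) ⨟ ((mk (Z 1 1 4) ⊠ mk (wires 2)) ⊠ mk (Z 1 1 4)) := by
  simp only [interchange, seq_id, id_seq]

/-- **Step 3**: with one `√2` each, the two columns' parallel pairs of wires are `π` phases
(Lemma 9), which slide onto the outputs; what remains below is the pair of crossed Hadamard cups.
[cite: JeandelPerdrixVilmart2018, Appendix Lemmas 4, 9] -/
theorem sqrt_two_sq_par_columns :
    mk (dumbbell 0 0) ⊠ (mk (dumbbell 0 0) ⊠ ((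
        (mk cup ⨟ ((mk (Z 1 2 0) ⨟ (mk (wires 1) ⊠ mk hBox) ⨟ mk (Z 2 1 0)) ⊠ mk hBox)) ⊠
        (mk cup ⨟ (mk hBox ⊠ (mk (Z 1 2 0) ⨟ (mk hBox ⊠ mk (wires 1)) ⨟ mk (Z 2 1 0))))) ⨟
          ((mk (wires 1) ⊠ mk swap) ⊠ mk (wires 1)) ⨟ (mk (Z 2 1 0) ⊠ mk (Z 2 1 0)))) =
      ((mk cup ⊠ mk cup) ⨟ ((mk (wires 1) ⊠ ((mk hBox ⊠ mk hBox) ⨟ mk swap)) ⊠ mk (wires 1)) ⨟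
        (mk (Z 2 1 0) ⊠ mk (Z 2 1 0))) ⨟ (mk (Z 1 1 4) ⊠ mk (Z 1 1 4)) := by
  -- the two columns with their `√2`
  have hL : mk (dumbbell 0 0) ⊠ (mk cup ⨟ ((mk (Z 1 2 0) ⨟ (mk (wires 1) ⊠ mk hBox) ⨟ mk (Z 2 1 0)) ⊠ mk hBox)) =
      mk cup ⨟ (mk (Z 1 1 4) ⊠ mk hBox) := by
    rw [← state_two_seq_scalar_par_two, show mk (dumbbell 0 0) ⊠ ((mk (Z 1 2 0) ⨟ (mk (wires 1) ⊠ mk hBox) ⨟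
      mk (Z 2 1 0)) ⊠ mk hBox) = (mk (dumbbell 0 0) ⊠ (mk (Z 1 2 0) ⨟ (mk (wires 1) ⊠ mk hBox) ⨟ mk (Z 2 1 0))) ⊠ mk hBox
      from (par_assoc' _ _ _).trans (cast_id _ _ _), sqrt_two_par_split_par_hBox_merge]
  have hR : mk (dumbbell 0 0) ⊠ (mk cup ⨟ (mk hBox ⊠ (mk (Z 1 2 0) ⨟ (mk hBox ⊠ mk (wires 1)) ⨟ mk (Z 2 1 0)))) =
      mk cup ⨟ (mk hBox ⊠ mk (Z 1 1 4)) := by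
    rw [← state_two_seq_scalar_par_two, show mk (dumbbell 0 0) ⊠ (mk hBox ⊠ (mk (Z 1 2 0) ⨟ (mk hBox ⊠ mk (wires 1)) ⨟
      mk (Z 2 1 0))) = (mk (dumbbell 0 0) ⊠ mk hBox) ⊠ (mk (Z 1 2 0) ⨟ (mk hBox ⊠ mk (wires 1)) ⨟ mk (Z 2 1 0))
      from (par_assoc' _ _ _).trans (cast_id _ _ _), scalar_par_one_comm (mk (dumbbell 0 0)) (mk hBox),
      show (mk hBox ⊠ mk (dumbbell 0 0)) ⊠ (mk (Z 1 2 0) ⨟ (mk hBox ⊠ mk (wires 1)) ⨟ mk (Z 2 1 0)) =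
        mk hBox ⊠ (mk (dumbbell 0 0) ⊠ (mk (Z 1 2 0) ⨟ (mk hBox ⊠ mk (wires 1)) ⨟ mk (Z 2 1 0)))
      from (par_assoc _ _ _).trans (cast_id _ _ _), sqrt_two_par_split_hBox_par_merge]
  -- regroupings
  have e12 : (mk (Z 1 1 4) ⊠ mk hBox) ⊠ (mk hBox ⊠ mk (Z 1 1 4)) = (mk (Z 1 1 4) ⊠ (mk hBox ⊠ mk hBox)) ⊠ mk (Z 1 1 4) := by
    rw [show (mk (Z 1 1 4) ⊠ mk hBox) ⊠ (mk hBox ⊠ mk (Z 1 1 4)) = mk (Z 1 1 4) ⊠ (mk hBox ⊠ (mk hBox ⊠ mk (Z 1 1 4)))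
      from (par_assoc _ _ _).trans (cast_id _ _ _), show mk hBox ⊠ (mk hBox ⊠ mk (Z 1 1 4)) = (mk hBox ⊠ mk hBox) ⊠ mk (Z 1 1 4)
      from (par_assoc' _ _ _).trans (cast_id _ _ _)]
    exact (par_assoc' _ _ _).trans (cast_id _ _ _)
  -- distribute the two `√2` over the two columns
  set Lcol := mk cup ⨟ ((mk (Z 1 2 0) ⨟ (mk (wires 1) ⊠ mk hBox) ⨟ mk (Z 2 1 0)) ⊠ mk hBox) with hLcol
  set Rcol := mk cup ⨟ (mk hBox ⊠ (mk (Z 1 2 0) ⨟ (mk hBox ⊠ mk (wires 1)) ⨟ mk (Z 2 1 0))) with hRcol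
  have eA : mk (dumbbell 0 0) ⊠ (Lcol ⊠ Rcol) = (mk (dumbbell 0 0) ⊠ Lcol) ⊠ Rcol := (par_assoc' _ _ _).trans (cast_id _ _ _)
  have eB : mk (dumbbell 0 0) ⊠ ((mk (dumbbell 0 0) ⊠ Lcol) ⊠ Rcol) = (mk (dumbbell 0 0) ⊠ Lcol) ⊠ (mk (dumbbell 0 0) ⊠ Rcol) := by
    rw [par_assoc', cast_id, scalar_par_state_two_comm (mk (dumbbell 0 0)) (mk (dumbbell 0 0) ⊠ Lcol)]
    exact (par_assoc _ _ _).trans (cast_id _ _ _)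
  rw [← scalar_par_state_four_seq_two, ← scalar_par_state_four_seq_four, eA, ← scalar_par_state_four_seq_two,
    ← scalar_par_state_four_seq_four, eB, hL, hR,
    ← interchange (mk cup) (mk (Z 1 1 4) ⊠ mk hBox) (mk cup) (mk hBox ⊠ mk (Z 1 1 4)), e12,
    seq_assoc (mk cup ⊠ mk cup), phase_hBoxes_phase_seq_par_swap_par, ← seq_assoc (mk cup ⊠ mk cup), seq_assoc _ _ (mk (Z 2 1 0) ⊠ mk (Z 2 1 0)),
    phases_par_seq_merges, ← seq_assoc]

/-! ### Step 4: the antiparallel pair — the Hopf law between the two crossed Hadamard cups -/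

/-- A cup next to a wire, followed by the crossing of the wire with the cup's near leg, is the cup
on the other side followed by the other crossing. [folklore] -/
theorem cup_par_seq_par_swap :
    (mk cup ⊠ mk (wires 1)) ⨟ (mk (wires 1) ⊠ mk swap) = (mk (wires 1) ⊠ mk cup) ⨟ (mk swap ⊠ mk (wires 1)) := by
  have h := swap_nat (mk cup)
  rw [bswap1_two, ← seq_assoc] at h
  have hσσ : (mk swap ⊠ mk (wires 1)) ⨟ (mk swap ⊠ mk (wires 1)) = mk (wires 3) := by
    rw [← seq_par_wires, swap_seq_swap, wires_par_wires]
  have h2 := congrArg (· ⨟ (mk swap ⊠ mk (wires 1))) h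
  simp only [bswap1_zero, id_seq] at h2
  rwa [seq_assoc _ (mk swap ⊠ mk (wires 1)), hσσ, seq_id] at h2

/-- **Crossed cups are nested cups followed by one crossing**:
`(η ⊗ η) ⨾ (𝕀 ⊗ σ ⊗ 𝕀) = η ⨾ (𝕀 ⊗ η ⊗ 𝕀) ⨾ (𝕀² ⊗ σ)`. [folklore] -/
theorem cups_seq_par_swap_par :
    (mk cup ⊠ mk cup) ⨟ ((mk (wires 1) ⊠ mk swap) ⊠ mk (wires 1)) =
      (mk cup ⨟ ((mk (wires 1) ⊠ mk cup) ⊠ mk (wires 1))) ⨟ (mk (wires 2) ⊠ mk swap) := by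
  have e17 : (mk (wires 1) ⊠ mk cup) ⊠ mk (wires 1) = mk (wires 1) ⊠ (mk cup ⊠ mk (wires 1)) :=
    (par_assoc _ _ _).trans (cast_id _ _ _)
  have e18 : mk (wires 2) ⊠ mk swap = mk (wires 1) ⊠ (mk (wires 1) ⊠ mk swap) := by
    rw [← wires_par_wires 1 1]; exact (par_assoc _ _ _).trans (cast_id _ _ _)
  have e19 : mk (wires 1) ⊠ (mk (wires 1) ⊠ mk cup) = mk (wires 2) ⊠ mk cup := by
    rw [← wires_par_wires 1 1]; exact (par_assoc' _ _ _).trans (cast_id _ _ _)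
  have e20 : mk (wires 1) ⊠ (mk swap ⊠ mk (wires 1)) = (mk (wires 1) ⊠ mk swap) ⊠ mk (wires 1) :=
    (par_assoc' _ _ _).trans (cast_id _ _ _)
  have hcc : mk cup ⨟ (mk (wires 2) ⊠ mk cup) = mk cup ⊠ mk cup := by
    rw [par_eq_seq_left (mk cup) (mk cup), par_empty]
  conv_rhs => rw [e17, e18, seq_assoc, interchange, id_seq, cup_par_seq_par_swap, wires_par_seq, e19, e20, ← seq_assoc, hcc]

/-- The Hadamard layer after the nested cups: the inner box slides to the inner cup's other leg.
[cite: JeandelPerdrixVilmart2018, §2.2] -/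
theorem par_cup_par_seq_hBoxes :
    ((mk (wires 1) ⊠ mk cup) ⊠ mk (wires 1)) ⨟ ((mk (wires 1) ⊠ mk hBox) ⊠ (mk (wires 1) ⊠ mk hBox)) =
      ((mk (wires 1) ⊠ mk cup) ⊠ mk (wires 1)) ⨟ (mk (wires 2) ⊠ (mk hBox ⊠ mk hBox)) := by
  have e15 : (mk (wires 1) ⊠ mk hBox) ⊠ (mk (wires 1) ⊠ mk hBox) = (mk (wires 1) ⊠ (mk hBox ⊠ mk (wires 1))) ⊠ mk hBox := by
    rw [show (mk (wires 1) ⊠ mk hBox) ⊠ (mk (wires 1) ⊠ mk hBox) = ((mk (wires 1) ⊠ mk hBox) ⊠ mk (wires 1)) ⊠ mk hBox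
      from (par_assoc' _ _ _).trans (cast_id _ _ _), show (mk (wires 1) ⊠ mk hBox) ⊠ mk (wires 1) =
      mk (wires 1) ⊠ (mk hBox ⊠ mk (wires 1)) from (par_assoc _ _ _).trans (cast_id _ _ _)]
  have e16 : (mk (wires 1) ⊠ (mk (wires 1) ⊠ mk hBox)) ⊠ mk hBox = mk (wires 2) ⊠ (mk hBox ⊠ mk hBox) := by
    rw [show mk (wires 1) ⊠ (mk (wires 1) ⊠ mk hBox) = mk (wires 2) ⊠ mk hBox from by
      rw [← wires_par_wires 1 1]; exact (par_assoc' _ _ _).trans (cast_id _ _ _)]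
    exact (par_assoc _ _ _).trans (cast_id _ _ _)
  rw [e15, interchange, ← wires_par_seq, cup_seq_hBox_par_comm, wires_par_seq]
  conv_rhs => rw [← e16, interchange]

/-- The crossing below the Hadamard layer `𝕀 ⊗ H ⊗ H ⊗ 𝕀` moves above it, the boxes following the wires. [folklore] -/
theorem par_swap_seq_hBoxes :
    (mk (wires 2) ⊠ mk swap) ⨟ ((mk (wires 1) ⊠ (mk hBox ⊠ mk hBox)) ⊠ mk (wires 1)) =
      ((mk (wires 1) ⊠ mk hBox) ⊠ (mk (wires 1) ⊠ mk hBox)) ⨟ (mk (wires 2) ⊠ mk swap) := by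
  have hs : mk swap ⨟ (mk hBox ⊠ mk (wires 1)) = (mk (wires 1) ⊠ mk hBox) ⨟ mk swap := by
    simpa using fswap1_nat (mk hBox)
  have e14 : (mk (wires 1) ⊠ (mk hBox ⊠ mk hBox)) ⊠ mk (wires 1) = (mk (wires 1) ⊠ mk hBox) ⊠ (mk hBox ⊠ mk (wires 1)) := by
    rw [show mk (wires 1) ⊠ (mk hBox ⊠ mk hBox) = (mk (wires 1) ⊠ mk hBox) ⊠ mk hBox from (par_assoc' _ _ _).trans (cast_id _ _ _)]
    exact (par_assoc _ _ _).trans (cast_id _ _ _)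
  rw [e14, ← wires_par_wires 1 1, interchange, hs, interchange (mk (wires 1)) (mk (wires 1)) (mk (wires 1)) (mk hBox),
    id_seq, id_seq]
  conv_rhs => rw [interchange, wires_par_wires, seq_id]

/-- **Step 4**: the two crossed Hadamard cups closed by two merges are two green nodes joined by two
Hadamard wires; redrawn as nested cups they are the Hopf pattern of `hopf_hBox_state`, so with
`√2 ⊗ √2` they disconnect into two phase-free green states. [cite: JeandelPerdrixVilmart2018, Appendix Lemma 3] -/
theorem sqrt_two_sq_par_crossed_hCups_merges :
    mk (dumbbell 0 0) ⊠ (mk (dumbbell 0 0) ⊠ ((mk cup ⊠ mk cup) ⨟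
      ((mk (wires 1) ⊠ ((mk hBox ⊠ mk hBox) ⨟ mk swap)) ⊠ mk (wires 1)) ⨟ (mk (Z 2 1 0) ⊠ mk (Z 2 1 0)))) =
      mk (Z 0 1 0) ⊠ mk (Z 0 1 0) := by
  rw [hBox_par_hBox_seq_swap, wires_par_seq, seq_par_wires, ← seq_assoc, cups_seq_par_swap_par, seq_assoc _ (mk (wires 2) ⊠ mk swap),
    par_swap_seq_hBoxes, ← seq_assoc, seq_assoc (mk cup), par_cup_par_seq_hBoxes, seq_assoc, seq_assoc,
    interchange (mk (wires 2)) (mk (Z 2 1 0)) (mk swap) (mk (Z 2 1 0)), id_seq, swap_spider, ← seq_assoc,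
    ← seq_assoc (mk cup) ((mk (wires 1) ⊠ mk cup) ⊠ mk (wires 1)) (mk (wires 2) ⊠ (mk hBox ⊠ mk hBox)),
    seq_assoc _ (mk (wires 2) ⊠ (mk hBox ⊠ mk hBox)) (mk (Z 2 1 0) ⊠ mk (Z 2 1 0)),
    interchange (mk (wires 2)) (mk (Z 2 1 0)) (mk hBox ⊠ mk hBox) (mk (Z 2 1 0)), id_seq,
    par_eq_seq_left (mk (Z 2 1 0)) ((mk hBox ⊠ mk hBox) ⨟ mk (Z 2 1 0)), ← seq_assoc, nested_cups_seq_merge]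
  exact hopf_hBox_state

/-! ### π-copy -/

/-- **π-copy for states** (Backens–Perdrix–Wang's `pidotcopy`, with JPV's scalars): the red split
copies the green `π` state, `√2 ⊗ (Z^{(0,1)}(π) ⨾ X^{(1,2)}) = Z^{(0,1)}(π) ⊗ Z^{(0,1)}(π)`.
[cite: JeandelPerdrixVilmart2018, Appendix Lemma 4] -/
theorem pidotcopy : mk (dumbbell 0 0) ⊠ (mk (Z 0 1 4) ⨟ mk (X 1 2 0)) = mk (Z 0 1 4) ⊠ mk (Z 0 1 4) := by
  conv_lhs => rw [← sqrt_two_par_hCup_seq_Z_merge, scalar_par_state_one_seq_two, hCup_merge_seq_X_split,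
    Z_state_hBox_X_split_hBox_merges, sqrt_two_sq_par_columns, ← scalar_par_state_two_seq_two,
    ← scalar_par_state_two_seq_two, sqrt_two_sq_par_crossed_hCups_merges, interchange, Z_seq_Z 0 1 1 le_rfl,
    zero_add (4 : ZMod 8)]

/-! ### (K1): the `π` phase is copied by the red spider -/

/-- A scalar passes a `1 → 2` map into the map after it. [folklore] -/
theorem one_two_seq_scalar_par_two (A : ZXClass 1 2) (s : ZXClass 0 0) (B : ZXClass 2 2) :
    A ⨟ (s ⊠ B) = s ⊠ (A ⨟ B) := by
  rw [scalar_par_seq_right, empty_par, cast_id]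

/-- A scalar attached to a `1 → 4` map stays in front when a map is appended (to four). [folklore] -/
theorem scalar_par_one_four_seq_four (s : ZXClass 0 0) (A : ZXClass 1 4) (B : ZXClass 4 4) :
    (s ⊠ A) ⨟ B = s ⊠ (A ⨟ B) := by
  rw [scalar_par_seq_left, empty_par, cast_id]

/-- A scalar attached to a `1 → 4` map stays in front when a map is appended (to two). [folklore] -/
theorem scalar_par_one_four_seq_two (s : ZXClass 0 0) (A : ZXClass 1 4) (B : ZXClass 4 2) :
    (s ⊠ A) ⨟ B = s ⊠ (A ⨟ B) := by
  rw [scalar_par_seq_left, empty_par, cast_id]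

/-- Two copies of a state next to two wires, crossed into place: `(s ⊗ s ⊗ 𝕀²) ⨾ (𝕀 ⊗ σ ⊗ 𝕀) = (s ⊗ 𝕀) ⊗ (s ⊗ 𝕀)`. [folklore] -/
theorem states_par_wires_seq_par_swap_par (s : ZXClass 0 1) :
    ((s ⊠ s) ⊠ mk (wires 2)) ⨟ ((mk (wires 1) ⊠ mk swap) ⊠ mk (wires 1)) = (s ⊠ mk (wires 1)) ⊠ (s ⊠ mk (wires 1)) := by
  have hsw : (s ⊠ mk (wires 1)) ⨟ mk swap = mk (wires 1) ⊠ s := by simpa using swap_nat s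
  have e1 : (s ⊠ s) ⊠ mk (wires 2) = s ⊠ ((s ⊠ mk (wires 1)) ⊠ mk (wires 1)) := by
    rw [← wires_par_wires 1 1, show (s ⊠ s) ⊠ (mk (wires 1) ⊠ mk (wires 1)) = s ⊠ (s ⊠ (mk (wires 1) ⊠ mk (wires 1)))
      from (par_assoc _ _ _).trans (cast_id _ _ _), show s ⊠ (mk (wires 1) ⊠ mk (wires 1)) = (s ⊠ mk (wires 1)) ⊠ mk (wires 1)
      from (par_assoc' _ _ _).trans (cast_id _ _ _)]
  have e2 : (mk (wires 1) ⊠ mk swap) ⊠ mk (wires 1) = mk (wires 1) ⊠ (mk swap ⊠ mk (wires 1)) :=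
    (par_assoc _ _ _).trans (cast_id _ _ _)
  have e3 : (s ⊠ mk (wires 1)) ⊠ (s ⊠ mk (wires 1)) = s ⊠ ((mk (wires 1) ⊠ s) ⊠ mk (wires 1)) := by
    rw [show (mk (wires 1) ⊠ s) ⊠ mk (wires 1) = mk (wires 1) ⊠ (s ⊠ mk (wires 1)) from (par_assoc _ _ _).trans (cast_id _ _ _)]
    exact (par_assoc _ _ _).trans (cast_id _ _ _)
  rw [e1, e2, interchange, seq_id, interchange, hsw, id_seq, e3]

/-- **JPV Lemma 4 = (K1)** (π-copy): `Z^{(1,1)}(π) ⨾ X^{(1,2)} = X^{(1,2)} ⨾ (Z^{(1,1)}(π) ⊗ Z^{(1,1)}(π))` —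
un-fuse the phase as a `π` state on a merge, bialgebra, `pidotcopy`, re-fuse. [cite: JeandelPerdrixVilmart2018, Appendix Lemma 4] -/
theorem K1 : mk (Z 1 1 4) ⨟ mk (X 1 2 0) = mk (X 1 2 0) ⨟ (mk (Z 1 1 4) ⊠ mk (Z 1 1 4)) := by
  have hπ : mk (Z 1 1 4) = (mk (Z 0 1 4) ⊠ mk (wires 1)) ⨟ mk (Z 2 1 0) := by
    rw [Z_par_seq_Z 0 1 1 1 le_rfl, add_zero (4 : ZMod 8)]
  have eY : mk (dumbbell 0 0) ⊠ ((mk (Z 0 1 4) ⨟ mk (X 1 2 0)) ⊠ mk (X 1 2 0)) =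
      (mk (dumbbell 0 0) ⊠ (mk (Z 0 1 4) ⨟ mk (X 1 2 0))) ⊠ mk (X 1 2 0) := (par_assoc' _ _ _).trans (cast_id _ _ _)
  have hX : mk (X 1 2 0) ⨟ ((mk (Z 0 1 4) ⊠ mk (Z 0 1 4)) ⊠ mk (wires 2)) = (mk (Z 0 1 4) ⊠ mk (Z 0 1 4)) ⊠ mk (X 1 2 0) := by
    rw [par_eq_seq_right (mk (Z 0 1 4) ⊠ mk (Z 0 1 4)) (mk (X 1 2 0)), empty_par, cast_id]
  conv_lhs => rw [hπ]
  rw [seq_assoc, ← rule_B2_red, one_two_seq_scalar_par_two, ← seq_assoc, ← seq_assoc, interchange, id_seq,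
    ← scalar_par_one_four_seq_two, ← scalar_par_one_four_seq_four, eY, pidotcopy, ← hX, seq_assoc (mk (X 1 2 0)),
    states_par_wires_seq_par_swap_par, seq_assoc, interchange, Z_par_seq_Z 0 1 1 1 le_rfl, add_zero (4 : ZMod 8)]

end ZXClass

end Literature.Computability.QuantumComplexity
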